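import Mathlib
import Summits.AtomisticToContinuum.Crystallization.Theses.GappedShellCensus
import Literature.Geometry.DiscreteGeometry.ShellCensusTwelve
import Literature.Geometry.DiscreteGeometry.KissingFanTriangleSets
import Summits.AtomisticToContinuum.Crystallization.Theorems.GappedShellCensusFiveFoldRationingRStubFfrLens
import Summits.AtomisticToContinuum.Crystallization.Theorems.GappedShellCensusFiveFoldRationingRStubFfrCircle
import Summits.AtomisticToContinuum.Crystallization.Theorems.GappedShellCensusFiveFoldRationingRStubFfrCommonLeFive
import Summits.AtomisticToContinuum.Crystallization.Theorems.GappedShellCensusFiveFoldRationingRStubFfrNoFreeSurface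
import Summits.AtomisticToContinuum.Crystallization.Theorems.GappedShellCensusFiveFoldRationingRStubFfrRelDense
import Summits.AtomisticToContinuum.Crystallization.Theorems.GappedShellCensusFiveFoldRationingRStubFfrParity
import Summits.AtomisticToContinuum.Crystallization.Theorems.GappedShellCensusFiveFoldRationingRStubFfrCountingZ
import Summits.AtomisticToContinuum.Crystallization.Theorems.GappedShellCensusFiveFoldRationingRStubFfrTwoPoles
import Summits.AtomisticToContinuum.Crystallization.Theorems.GappedShellCensusFiveFoldRationingRStubFfrChain
import Summits.AtomisticToContinuum.Crystallization.Theorems.GappedShellCensusFiveFoldRationingRStubFfrLinkGlue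
import Summits.AtomisticToContinuum.Crystallization.Theorems.GappedShellCensusFiveFoldRationingRStubFfrFoamGlue
import Summits.AtomisticToContinuum.Crystallization.Theorems.GappedShellCensusFiveFoldRationingRStubFfrLineCensusC
import Summits.AtomisticToContinuum.Crystallization.Theorems.GappedShellCensusFiveFoldRationingRStubFfrCensus5Aux1
import Summits.AtomisticToContinuum.Crystallization.Theorems.GappedShellCensusFiveFoldRationingRStubFfrCensus5Aux2
import Summits.AtomisticToContinuum.Crystallization.Theorems.GappedShellCensusFiveFoldRationingRStubFfrC5Dict
import Summits.AtomisticToContinuum.Crystallization.Theorems.GappedShellCensusFiveFoldRationingRStubFfrC5Kills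
import Summits.AtomisticToContinuum.Crystallization.Theorems.GappedShellCensusFiveFoldRationingRStubFfrC5Core
import Summits.AtomisticToContinuum.Crystallization.Theorems.GappedShellCensusFiveFoldRationingRStubFfrGreedy
import Summits.AtomisticToContinuum.Crystallization.Theorems.GappedShellCensusFiveFoldRationingRStubFfrQuasiGlue
import Summits.AtomisticToContinuum.Crystallization.Theorems.GappedShellCensusFiveFoldRationingRStubFfrC5CertFacesOf
import Summits.AtomisticToContinuum.Crystallization.Theorems.GappedShellCensusFiveFoldRationingRStubFfrCensus4
import Summits.AtomisticToContinuum.Crystallization.Theorems.GappedShellCensusFiveFoldRationingRStubFfrVolGrowth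
import Summits.AtomisticToContinuum.Crystallization.Theorems.GappedShellCensusFiveFoldRationingRStubFfrRodTransfer
import Summits.AtomisticToContinuum.Crystallization.Theorems.GappedShellCensusFiveFoldRationingRStubFfrC5NoOpenStarEntry
import Summits.AtomisticToContinuum.Crystallization.Theorems.GappedShellCensusFiveFoldRationingRStubFfrC5NoFarFacetEntry
import Literature.Geometry.DiscreteGeometry.ShellCensusReplayEscapeSound
import Literature.Geometry.DiscreteGeometry.ShellCensusReplayEscapeText

/-!
# Split glue for the crux `GappedShellCensus.FiveFoldRationingR` (stmt-AtomisticToContinuum-18071)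

Strategist decomposition (unit `cstrat-stmt-AtomisticToContinuum-18071-s1`).  The lead line `Sketch` (skeleton v15,
unit `line-…-18071-c3`) has landed every stub of the crux except THREE: the two twelve-point certificate targets
`stub_ffrC5NoFarFacet` (C2′: no hull facet of the normalised shell with two far sides) and `stub_ffrC5NoOpenStar`
(C1′: no open `4T+Q` star), and the deep vocabulary-free graph theorem `stub_ffrRodGraph` (RG: connected graph
with cubocta / anticubocta / bicapped-prism labelled links and cubic ball growth ⇒ five-bond axis uniqueness +
height function).  This file is the kernel-checked IMPLICATION

  `fiveFoldRationingR_of_subs : C2′ → C1′ → RG → FiveFoldRationingR`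

with the three statements as hypotheses (section variables `hC2`, `hC1`, `hRG`) and everything else supplied by
the landed stub modules (`…StubFfr*`), so that the three statements can be promoted to route items (children
`C5NoFarFacet`, `C5NoOpenStar`, `RodGraph` of `FiveFoldRationingR`).  `ffrS_c5certX_of`, `ffrS_census5_of` and
`ffrS_linkTypes_of` are the lead's v15 compositions verbatim with the certificate stubs replaced by `hC2`, `hC1`;
`ffrS_censusZ_of` composes the landed rod transfer / quasi-geodesy / foam glue / line census under `hRG`.
No statement of the line is changed.  Axioms beyond the whitelist: those of `stub_ffrCensus4` (computational lane,
`native_decide` through the sibling's `ShellCensusSearch*`).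
-/

noncomputable section

namespace Summit.AtomisticToContinuum.Crystallization.Theorems

open Summit.AtomisticToContinuum.Crystallization.Theses.GappedShellCensus
open Literature.Geometry.DiscreteGeometry

section Split

-- Hypothesis C2′ = the registered stub `stub_ffrC5NoFarFacet` (route child `C5NoFarFacet`).
variable (hC2 : ∀ t : Fin 12 → EuclideanSpace ℝ (Fin 3),
      (∀ k, 1 - 1 / 50 ≤ ‖t k‖ ∧ ‖t k‖ ≤ 1 + 1 / 50) →
      (∀ k l, k ≠ l → 1 - 1 / 50 ≤ dist (t k) (t l) ∧ (dist (t k) (t l) ≤ 1 + 1 / 50 ∨ 63 / 50 ≤ dist (t k) (t l))) →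
      (∀ k, 4 ≤ (Finset.univ.filter fun l => l ≠ k ∧ dist (t k) (t l) ≤ 1 + 1 / 50).card) →
      (∀ k, (Finset.univ.filter fun l => l ≠ k ∧ dist (t k) (t l) ≤ 1 + 1 / 50).card ≤ 5) →
      ∀ p q r : Fin 12, p ≠ q → p ≠ r → q ≠ r →
        63 / 50 ≤ dist (t p) (t q) → 63 / 50 ≤ dist (t p) (t r) →
        (∃ c : EuclideanSpace ℝ (Fin 3), inner ℝ c (‖t p‖⁻¹ • t p) = 1 ∧ inner ℝ c (‖t q‖⁻¹ • t q) = 1 ∧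
          inner ℝ c (‖t r‖⁻¹ • t r) = 1 ∧ ∀ l, inner ℝ c (‖t l‖⁻¹ • t l) ≤ 1) → False)

-- Hypothesis C1′ = the registered stub `stub_ffrC5NoOpenStar` (route child `C5NoOpenStar`).
variable (hC1 : ∀ t : Fin 12 → EuclideanSpace ℝ (Fin 3),
      (∀ k, 1 - 1 / 50 ≤ ‖t k‖ ∧ ‖t k‖ ≤ 1 + 1 / 50) →
      (∀ k l, k ≠ l → 1 - 1 / 50 ≤ dist (t k) (t l) ∧ (dist (t k) (t l) ≤ 1 + 1 / 50 ∨ 63 / 50 ≤ dist (t k) (t l))) →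
      (∀ k, 4 ≤ (Finset.univ.filter fun l => l ≠ k ∧ dist (t k) (t l) ≤ 1 + 1 / 50).card) →
      (∀ k, (Finset.univ.filter fun l => l ≠ k ∧ dist (t k) (t l) ≤ 1 + 1 / 50).card ≤ 5) →
      ∀ v a₁ a₂ a₃ a₄ a₅ x : Fin 12, Function.Injective ![v, a₁, a₂, a₃, a₄, a₅, x] →
        dist (t v) (t a₁) ≤ 1 + 1 / 50 → dist (t v) (t a₂) ≤ 1 + 1 / 50 → dist (t v) (t a₃) ≤ 1 + 1 / 50 →
        dist (t v) (t a₄) ≤ 1 + 1 / 50 → dist (t v) (t a₅) ≤ 1 + 1 / 50 →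
        dist (t a₁) (t a₂) ≤ 1 + 1 / 50 → dist (t a₂) (t a₃) ≤ 1 + 1 / 50 → dist (t a₃) (t a₄) ≤ 1 + 1 / 50 →
        dist (t a₄) (t a₅) ≤ 1 + 1 / 50 → 63 / 50 ≤ dist (t a₅) (t a₁) →
        dist (t x) (t a₅) ≤ 1 + 1 / 50 → dist (t x) (t a₁) ≤ 1 + 1 / 50 → 63 / 50 ≤ dist (t v) (t x) → False)

-- Hypothesis RG = the registered stub `stub_ffrRodGraph` (route child `RodGraph`).
variable (hRG :
    ∀ (V : Type) (G : SimpleGraph V),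
      (∀ v : V, ∃ e : Fin 12 → V, Function.Injective e ∧ Set.range e = {w | G.Adj v w} ∧
        ((∀ i j : Fin 12, i < j → (G.Adj (e i) (e j) ↔
            (i.val, j.val) ∈ ([(0, 4), (0, 5), (0, 8), (0, 9), (1, 4), (1, 5), (1, 10), (1, 11), (2, 6), (2, 7),
                (2, 8), (2, 9), (3, 6), (3, 7), (3, 10), (3, 11), (4, 8), (4, 10), (5, 9), (5, 11),
                (6, 8), (6, 10), (7, 9), (7, 11)] : List (ℕ × ℕ)))) ∨
          (∀ i j : Fin 12, i < j → (G.Adj (e i) (e j) ↔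
            (i.val, j.val) ∈ ([(0, 2), (0, 5), (0, 7), (0, 10), (1, 3), (1, 4), (1, 8), (1, 11), (2, 4), (2, 6),
                (2, 9), (3, 5), (3, 8), (3, 11), (4, 6), (4, 9), (5, 7), (5, 10), (6, 7), (6, 8),
                (7, 8), (9, 10), (9, 11), (10, 11)] : List (ℕ × ℕ)))) ∨
          (∀ i j : Fin 12, i < j → (G.Adj (e i) (e j) ↔
            (i.val, j.val) ∈ ([(0, 1), (0, 2), (0, 3), (0, 4), (0, 5), (1, 2), (1, 5), (1, 6), (2, 3), (2, 7), (3, 4),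
                (3, 8), (4, 5), (4, 9), (5, 10), (6, 7), (6, 10), (6, 11), (7, 8), (7, 11), (8, 9),
                (8, 11), (9, 10), (9, 11), (10, 11)] : List (ℕ × ℕ)))))) →
      G.Connected →
      (∃ (r₀ : ℕ) (c : ℝ), 0 < c ∧ ∀ (v : V) (r : ℕ), r₀ ≤ r →
        c * (r : ℝ) ^ 3 ≤ (({w | G.dist v w ≤ r} : Set V).ncard : ℝ)) →
      (∀ y ∈ {y : V | ∃ v, G.Adj y v ∧ 5 ≤ ({w | G.Adj y w ∧ G.Adj v w} : Set V).ncard},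
        ∀ y' ∈ {y : V | ∃ v, G.Adj y v ∧ 5 ≤ ({w | G.Adj y w ∧ G.Adj v w} : Set V).ncard},
        ∃ f : ℕ → V, f 0 = y ∧
          (∀ n, f (n + 1) ∈ {v | G.Adj (f n) v ∧ 5 ≤ ({w | G.Adj (f n) w ∧ G.Adj v w} : Set V).ncard}) ∧
          ∃ n, f n = y') ∧
      (∃ h : V → ℝ,
        (∀ u v : V, G.Adj u v → |h u - h v| ≤ 1) ∧
        (∀ y : V, ∀ v ∈ {v | G.Adj y v ∧ 5 ≤ ({w | G.Adj y w ∧ G.Adj v w} : Set V).ncard}, |h y - h v| = 1) ∧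
        (∀ y : V, ∀ v ∈ {v | G.Adj y v ∧ 5 ≤ ({w | G.Adj y w ∧ G.Adj v w} : Set V).ncard},
          ∀ v' ∈ {v | G.Adj y v ∧ 5 ≤ ({w | G.Adj y w ∧ G.Adj v w} : Set V).ncard},
          v ≠ v' → h v + h v' = 2 * h y)))

include hC2 hC1 in
/-- The certificate conjunction (former `stub_ffrC5CertX`) from C2′ through the landed dictionary half
`stub_ffrC5CertFacesOf` (p149940) and C1′. -/
theorem ffrS_c5certX_of (t : Fin 12 → EuclideanSpace ℝ (Fin 3))
    (hn : ∀ k, 1 - 1 / 50 ≤ ‖t k‖ ∧ ‖t k‖ ≤ 1 + 1 / 50)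
    (hd : ∀ k l, k ≠ l → 1 - 1 / 50 ≤ dist (t k) (t l) ∧ (dist (t k) (t l) ≤ 1 + 1 / 50 ∨ 63 / 50 ≤ dist (t k) (t l)))
    (h4 : ∀ k, 4 ≤ (Finset.univ.filter fun l => l ≠ k ∧ dist (t k) (t l) ≤ 1 + 1 / 50).card)
    (h5 : ∀ k, (Finset.univ.filter fun l => l ≠ k ∧ dist (t k) (t l) ≤ 1 + 1 / 50).card ≤ 5) :
    (∀ S ∈ (Finset.univ.powerset.filter fun S : Finset (Fin 12) =>
        S.image (fun k => ‖t k‖⁻¹ • t k) ∈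
          Literature.Geometry.DiscreteGeometry.fanTriSets (Finset.univ.image fun k => ‖t k‖⁻¹ • t k)),
      ∃ a ∈ S, ∀ b ∈ S, b ≠ a → dist (t a) (t b) ≤ 1 + 1 / 50) ∧
    (∀ v a₁ a₂ a₃ a₄ a₅ x : Fin 12, Function.Injective ![v, a₁, a₂, a₃, a₄, a₅, x] →
      dist (t v) (t a₁) ≤ 1 + 1 / 50 → dist (t v) (t a₂) ≤ 1 + 1 / 50 → dist (t v) (t a₃) ≤ 1 + 1 / 50 →
      dist (t v) (t a₄) ≤ 1 + 1 / 50 → dist (t v) (t a₅) ≤ 1 + 1 / 50 →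
      dist (t a₁) (t a₂) ≤ 1 + 1 / 50 → dist (t a₂) (t a₃) ≤ 1 + 1 / 50 → dist (t a₃) (t a₄) ≤ 1 + 1 / 50 →
      dist (t a₄) (t a₅) ≤ 1 + 1 / 50 → 63 / 50 ≤ dist (t a₅) (t a₁) →
      dist (t x) (t a₅) ≤ 1 + 1 / 50 → dist (t x) (t a₁) ≤ 1 + 1 / 50 → 63 / 50 ≤ dist (t v) (t x) → False) :=
  ⟨stub_ffrC5CertFacesOf t hn hd (hC2 t hn hd h4 h5), hC1 t hn hd h4 h5⟩

include hC2 hC1 in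
/-- The capped census `stub_ffrCensus5`, derived (the lead's v15 glue verbatim, certificate from `hC2 hC1`). -/
theorem ffrS_census5_of :
    (∀ t : Fin 12 → EuclideanSpace ℝ (Fin 3), Function.Injective t →
        (∀ k, 1 - 1 / 50 ≤ ‖t k‖ ∧ ‖t k‖ ≤ 1 + 1 / 50) →
        (∀ k l, k ≠ l → 1 - 1 / 50 ≤ dist (t k) (t l) ∧ (dist (t k) (t l) ≤ 1 + 1 / 50 ∨ 63 / 50 ≤ dist (t k) (t l))) →
        (∀ k, 4 ≤ (Finset.univ.filter fun l => l ≠ k ∧ dist (t k) (t l) ≤ 1 + 1 / 50).card) →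
        (∀ k, (Finset.univ.filter fun l => l ≠ k ∧ dist (t k) (t l) ≤ 1 + 1 / 50).card ≤ 5) →
        (∃ k, 5 ≤ (Finset.univ.filter fun l => l ≠ k ∧ dist (t k) (t l) ≤ 1 + 1 / 50).card) →
        ∃ σ : Equiv.Perm (Fin 12), ∀ k l : Fin 12, k < l →
          (dist (t (σ k)) (t (σ l)) ≤ 1 + 1 / 50 ↔ (k.val, l.val) ∈ ([(0, 1), (0, 2), (0, 3), (0, 4), (0, 5), (1, 2), (1, 5), (1, 6), (2, 3), (2, 7), (3, 4),
                (3, 8), (4, 5), (4, 9), (5, 10), (6, 7), (6, 10), (6, 11), (7, 8), (7, 11), (8, 9),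
                (8, 11), (9, 10), (9, 11), (10, 11)] : List (ℕ × ℕ)))) := by
  intro t hinj hn hd h4 h5 h5ex
  -- the all-five case is the icosahedron kill
  by_cases hall : ∀ k, (Finset.univ.filter fun l => l ≠ k ∧ dist (t k) (t l) ≤ 1 + 1 / 50).card = 5
  · exact (stub_ffrC5NoIcos t hn hd hall).elim
  -- dictionary and certificate on the concrete fan data
  obtain ⟨⟨tri_card, card_tri, two_per_side, bond_side, bond_tri, link⟩,
    ⟨ang_nonneg, ang_zero, sum_ang, tCorner, tCornerMin, hCorner, qCorner, qCornerMin, hPairMin⟩⟩ :=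
    stub_ffrC5Dict t hinj hn hd h4
  obtain ⟨c2, c1⟩ := ffrS_c5certX_of hC2 hC1 t hn hd h4 h5
  -- the bond relation as a Boolean
  set bond : Fin 12 → Fin 12 → Bool := fun v w => decide (v ≠ w ∧ dist (t v) (t w) ≤ 1 + 1 / 50) with hbdef
  have hbond : ∀ v w, bond v w = true ↔ v ≠ w ∧ dist (t v) (t w) ≤ 1 + 1 / 50 := fun v w => by
    simp only [hbdef, decide_eq_true_eq]
  have hfar : ∀ v w, bond v w = false → v ≠ w → 63 / 50 ≤ dist (t v) (t w) := by
    intro v w h hvw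
    have h' : ¬ (v ≠ w ∧ dist (t v) (t w) ≤ 1 + 1 / 50) := fun hh => by
      rw [(hbond v w).2 hh] at h; exact Bool.noConfusion h
    rcases (hd v w hvw).2 with hle | hge
    · exact absurd ⟨hvw, hle⟩ h'
    · exact hge
  have bond_symm : ∀ v w, bond v w = bond w v := by
    intro v w
    rcases Bool.eq_false_or_eq_true (bond v w) with h | h <;>
      rcases Bool.eq_false_or_eq_true (bond w v) with h' | h' <;> rw [h, h']
    · exfalso
      have := (hbond v w).1 h
      rw [dist_comm] at this
      exact Bool.eq_false_iff.1 h' |>.elim ((hbond w v).2 ⟨this.1.symm, this.2⟩)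
    · exfalso
      have := (hbond w v).1 h'
      rw [dist_comm] at this
      exact Bool.eq_false_iff.1 h |>.elim ((hbond v w).2 ⟨this.1.symm, this.2⟩)
  have bond_irrefl : ∀ v, bond v v = false := fun v =>
    Bool.eq_false_iff.2 fun h => ((hbond v v).1 h).1 rfl
  have hdegEq : ∀ v, (Finset.univ.filter fun w => bond v w = true).card =
      (Finset.univ.filter fun l => l ≠ v ∧ dist (t v) (t l) ≤ 1 + 1 / 50).card := by
    intro v
    congr 1
    ext w
    simp only [Finset.mem_filter, Finset.mem_univ, true_and, hbond v w, ne_comm]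
  have bond_deg : ∀ v, 4 ≤ (Finset.univ.filter fun w => bond v w = true).card ∧
      (Finset.univ.filter fun w => bond v w = true).card ≤ 5 := fun v => by
    rw [hdegEq v]; exact ⟨h4 v, h5 v⟩
  have h5ex' : ∃ v, (Finset.univ.filter fun w => bond v w = true).card = 5 := by
    obtain ⟨k, hk⟩ := h5ex
    exact ⟨k, by rw [hdegEq k]; exact le_antisymm (h5 k) hk⟩
  have h4ex' : ∃ v, (Finset.univ.filter fun w => bond v w = true).card = 4 := by
    push Not at hall
    obtain ⟨k, hk⟩ := hall
    refine ⟨k, ?_⟩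
    rw [hdegEq k]
    have h4k := h4 k
    have h5k := h5 k
    omega
  -- the dictionary in Boolean form
  have bond_side' : ∀ v w, bond v w = true →
      ((Finset.univ.powerset.filter fun S => S.image (fun k => ‖t k‖⁻¹ • t k) ∈
          fanTriSets (Finset.univ.image fun k => ‖t k‖⁻¹ • t k)).filter
        fun S' => ({v, w} : Finset (Fin 12)) ⊆ S').card = 2 := fun v w h =>
    bond_side v w ((hbond v w).1 h).1 ((hbond v w).1 h).2
  have bond_tri' : ∀ a b c, a ≠ b → b ≠ c → a ≠ c → bond a b = true → bond b c = true → bond a c = true →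
      ({a, b, c} : Finset (Fin 12)) ∈
        (Finset.univ.powerset.filter fun S => S.image (fun k => ‖t k‖⁻¹ • t k) ∈
          fanTriSets (Finset.univ.image fun k => ‖t k‖⁻¹ • t k)) :=
    fun a b c hab hbc hac h1 h2 h3 =>
      bond_tri a b c hab hbc hac ((hbond a b).1 h1).2 ((hbond b c).1 h2).2 ((hbond a c).1 h3).2
  have tCorner' := fun S hS (hall' : ∀ v ∈ S, ∀ w ∈ S, v ≠ w → bond v w = true) v hv =>
    tCorner S hS (fun v hv w hw hvw => ((hbond v w).1 (hall' v hv w hw hvw)).2) v hv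
  have tCornerMin' := fun S hS (hall' : ∀ v ∈ S, ∀ w ∈ S, v ≠ w → bond v w = true) v hv =>
    tCornerMin S hS (fun v hv w hw hvw => ((hbond v w).1 (hall' v hv w hw hvw)).2) v hv
  have hCorner' := fun v a x hS (h1 : bond v a = true) (h2 : bond a x = true) (h3 : bond v x = false)
      (hvx : v ≠ x) =>
    hCorner v a x hS ((hbond v a).1 h1).2 ((hbond a x).1 h2).2 (hfar v x h3 hvx)
  have qCorner' := fun v d a x hS (h1 : bond v d = true) (h2 : bond v a = true) (h3 : bond d a = false)
      (hda : d ≠ a) (h4' : bond d x = true) (h5' : bond x a = true) (h6 : bond v x = false) (hxv : x ≠ v) =>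
    qCorner v d a x hS ((hbond v d).1 h1).2 ((hbond v a).1 h2).2 (hfar d a h3 hda)
      ((hbond d x).1 h4').2 ((hbond x a).1 h5').2 (hfar v x h6 hxv.symm)
  have qCornerMin' := fun v d a hS (h1 : bond v d = true) (h2 : bond v a = true) (h3 : bond d a = false)
      (hda : d ≠ a) =>
    qCornerMin v d a hS ((hbond v d).1 h1).2 ((hbond v a).1 h2).2 (hfar d a h3 hda)
  have hPairMin' := fun v a x z hS hS' (h1 : bond v a = true) (h2 : bond v z = true) (h3 : bond a z = false)
      (haz : a ≠ z) =>
    hPairMin v a x z hS hS' ((hbond v a).1 h1).2 ((hbond v z).1 h2).2 (hfar a z h3 haz)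
  -- the certificate in Boolean form
  have two_bond_sides : ∀ S ∈ (Finset.univ.powerset.filter fun S => S.image (fun k => ‖t k‖⁻¹ • t k) ∈
      fanTriSets (Finset.univ.image fun k => ‖t k‖⁻¹ • t k)),
      ∃ a ∈ S, ∀ b ∈ S, b ≠ a → bond a b = true := by
    intro S hS
    obtain ⟨a, ha, h⟩ := c2 S hS
    exact ⟨a, ha, fun b hb hba => (hbond a b).2 ⟨hba.symm, h b hb hba⟩⟩
  have noOpenStar : ∀ v a₁ a₂ a₃ a₄ a₅ x : Fin 12, Function.Injective ![v, a₁, a₂, a₃, a₄, a₅, x] →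
      bond v a₁ = true → bond v a₂ = true → bond v a₃ = true → bond v a₄ = true → bond v a₅ = true →
      bond a₁ a₂ = true → bond a₂ a₃ = true → bond a₃ a₄ = true → bond a₄ a₅ = true → bond a₅ a₁ = false →
      bond x a₅ = true → bond x a₁ = true → bond v x = false → False := by
    intro v a₁ a₂ a₃ a₄ a₅ x hι b1 b2 b3 b4 b5 p1 p2 p3 p4 f51 x5 x1 fvx
    have h51 : a₅ ≠ a₁ := fun h => by
      have := hι (a₁ := 5) (a₂ := 1) (by simp [h])
      exact absurd this (by decide)
    have hvx : v ≠ x := fun h => by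
      have := hι (a₁ := 0) (a₂ := 6) (by simp [h])
      exact absurd this (by decide)
    exact c1 v a₁ a₂ a₃ a₄ a₅ x hι ((hbond _ _).1 b1).2 ((hbond _ _).1 b2).2 ((hbond _ _).1 b3).2
      ((hbond _ _).1 b4).2 ((hbond _ _).1 b5).2 ((hbond _ _).1 p1).2 ((hbond _ _).1 p2).2
      ((hbond _ _).1 p3).2 ((hbond _ _).1 p4).2 (hfar _ _ f51 h51) ((hbond _ _).1 x5).2
      ((hbond _ _).1 x1).2 (hfar _ _ fvx hvx)
  -- kills, core
  obtain ⟨five_T, four_T⟩ := stub_ffrC5Kills bond _ _ bond_symm bond_irrefl bond_deg tri_card card_tri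
    two_per_side bond_side' bond_tri' link ang_nonneg ang_zero sum_ang tCorner' tCornerMin' hCorner'
    qCorner' qCornerMin' hPairMin' two_bond_sides noOpenStar
  obtain ⟨σ, hσ⟩ := stub_ffrC5Core bond _ bond_symm bond_irrefl bond_deg h4ex' h5ex' tri_card card_tri
    two_per_side bond_side' bond_tri' link two_bond_sides five_T four_T
  refine ⟨σ, fun k l hkl => ?_⟩
  rw [← hσ k l hkl, hbond]
  exact ⟨fun h => ⟨σ.injective.ne (ne_of_lt hkl), h⟩, fun h => h.2⟩

include hC2 hC1 in
/-- Link types (L4 landed + L5 derived + landed `stub_ffrLinkGlue`). -/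
theorem ffrS_linkTypes_of :
    ∀ (Y : Set (EuclideanSpace ℝ (Fin 3))) (a : ℝ), 0 < a →
      (∀ y ∈ Y, ({w ∈ Y | w ≠ y ∧ dist y w ≤ a * (1 + 1 / 50)}.ncard = 12 ∧
        ∀ w ∈ Y, w ≠ y → a * (1 - 1 / 50) ≤ dist y w ∧
          (dist y w ≤ a * (1 + 1 / 50) ∨ a * (63 / 50) ≤ dist y w))) →
      (∀ y ∈ Y, ∀ v ∈ Y, v ≠ y → dist y v ≤ a * (1 + 1 / 50) →
        4 ≤ {w ∈ Y | w ≠ y ∧ w ≠ v ∧ dist y w ≤ a * (1 + 1 / 50) ∧ dist v w ≤ a * (1 + 1 / 50)}.ncard) →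
      (∀ y ∈ Y, ∀ v ∈ Y, v ≠ y → dist y v ≤ a * (1 + 1 / 50) →
        {w ∈ Y | w ≠ y ∧ w ≠ v ∧ dist y w ≤ a * (1 + 1 / 50) ∧ dist v w ≤ a * (1 + 1 / 50)}.ncard ≤ 5) →
      (∀ y ∈ Y, ∃ e : Fin 12 → EuclideanSpace ℝ (Fin 3), Function.Injective e ∧
        Set.range e = {w ∈ Y | w ≠ y ∧ dist y w ≤ a * (1 + 1 / 50)} ∧
        ((∀ i j : Fin 12, i < j → (dist (e i) (e j) ≤ a * (1 + 1 / 50) ↔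
            (i.val, j.val) ∈ ([(0, 4), (0, 5), (0, 8), (0, 9), (1, 4), (1, 5), (1, 10), (1, 11), (2, 6), (2, 7),
                (2, 8), (2, 9), (3, 6), (3, 7), (3, 10), (3, 11), (4, 8), (4, 10), (5, 9), (5, 11),
                (6, 8), (6, 10), (7, 9), (7, 11)] : List (ℕ × ℕ)))) ∨
          (∀ i j : Fin 12, i < j → (dist (e i) (e j) ≤ a * (1 + 1 / 50) ↔
            (i.val, j.val) ∈ ([(0, 2), (0, 5), (0, 7), (0, 10), (1, 3), (1, 4), (1, 8), (1, 11), (2, 4), (2, 6),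
                (2, 9), (3, 5), (3, 8), (3, 11), (4, 6), (4, 9), (5, 7), (5, 10), (6, 7), (6, 8),
                (7, 8), (9, 10), (9, 11), (10, 11)] : List (ℕ × ℕ)))) ∨
          (∀ i j : Fin 12, i < j → (dist (e i) (e j) ≤ a * (1 + 1 / 50) ↔
            (i.val, j.val) ∈ ([(0, 1), (0, 2), (0, 3), (0, 4), (0, 5), (1, 2), (1, 5), (1, 6), (2, 3), (2, 7), (3, 4),
                (3, 8), (4, 5), (4, 9), (5, 10), (6, 7), (6, 10), (6, 11), (7, 8), (7, 11), (8, 9),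
                (8, 11), (9, 10), (9, 11), (10, 11)] : List (ℕ × ℕ)))))) :=
  fun Y a ha hgap htf hF1 => stub_ffrLinkGlue Y a ha hgap htf hF1 stub_ffrCensus4 (ffrS_census5_of hC2 hC1)

include hC2 hC1 hRG in
/-- The zero-density census of five-sites: link types ⇒ no branching ⇒ walks ⇒ rod (RG) ⇒ one quasi-line ⇒ zero density. -/
theorem ffrS_censusZ_of :
    ∀ (Y : Set (EuclideanSpace ℝ (Fin 3))) (a : ℝ), 0 < a → Y.Nonempty →
      (∀ y ∈ Y, ({w ∈ Y | w ≠ y ∧ dist y w ≤ a * (1 + 1 / 50)}.ncard = 12 ∧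
        ∀ w ∈ Y, w ≠ y → a * (1 - 1 / 50) ≤ dist y w ∧
          (dist y w ≤ a * (1 + 1 / 50) ∨ a * (63 / 50) ≤ dist y w))) →
      (∀ y ∈ Y, ∀ v ∈ Y, v ≠ y → dist y v ≤ a * (1 + 1 / 50) →
        4 ≤ {w ∈ Y | w ≠ y ∧ w ≠ v ∧ dist y w ≤ a * (1 + 1 / 50) ∧ dist v w ≤ a * (1 + 1 / 50)}.ncard) →
      (∀ y ∈ Y, ∀ v ∈ Y, v ≠ y → dist y v ≤ a * (1 + 1 / 50) →
        {w ∈ Y | w ≠ y ∧ w ≠ v ∧ dist y w ≤ a * (1 + 1 / 50) ∧ dist v w ≤ a * (1 + 1 / 50)}.ncard ≤ 5) →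
      (∀ y ∈ Y, Even {v ∈ Y | v ≠ y ∧ dist y v ≤ a * (1 + 1 / 50) ∧
          5 ≤ {w ∈ Y | w ≠ y ∧ w ≠ v ∧ dist y w ≤ a * (1 + 1 / 50) ∧
            dist v w ≤ a * (1 + 1 / 50)}.ncard}.ncard) →
      (∀ p : EuclideanSpace ℝ (Fin 3), ∃ y ∈ Y, dist p y ≤ 3 * a) →
      ∀ ε : ℝ, 0 < ε → ∀ r₀ : ℝ, ∃ (p : EuclideanSpace ℝ (Fin 3)) (r : ℝ), r₀ ≤ r ∧
        (({y ∈ Y | ∃ v ∈ Y, v ≠ y ∧ dist y v ≤ a * (1 + 1 / 50) ∧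
          5 ≤ {w ∈ Y | w ≠ y ∧ w ≠ v ∧ dist y w ≤ a * (1 + 1 / 50) ∧
            dist v w ≤ a * (1 + 1 / 50)}.ncard} ∩ Metric.closedBall p r).ncard : ℝ) ≤ ε * (r / a) ^ 3 := by
  intro Y a ha hne hgap htf hF1 hPar _hRD
  -- link types (L: C2′, C1′ + landed layer), no branching, walks, greedy routing
  have hL := ffrS_linkTypes_of hC2 hC1 Y a ha hgap htf hF1
  have hN := stub_ffrTwoPoles Y a ha hgap htf hL
  have hW := stub_ffrChain Y a ha hN
  have hG := stub_ffrGreedy Y a ha hgap htf hL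
  -- the rod on `Y` (RG through the landed transfer + volume growth), quasi-geodesy, foam rigidity, line census
  have hRod := stub_ffrRodTransfer hRG stub_ffrVolGrowth Y a ha hne hgap htf hF1 hPar hN hW hL hG
  have hQ := stub_ffrQuasiGlue Y a ha hgap hG hRod.2
  have hF := stub_ffrFoamGlue Y a ha hN hW hRod.1 hQ
  exact stub_ffrLineCensusC Y a ha hF

include hC2 hC1 hRG in
/-- **Split glue (kernel-checked): `C2′ → C1′ → RG → FiveFoldRationingR`**, the crux BY NAME. -/
theorem fiveFoldRationingR_of_subs : FiveFoldRationingR := by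
  intro Y a ha hne hgap htf
  have hF1 := stub_ffrCommonLeFive stub_ffrLens stub_ffrCircle.1 Y a ha hgap
  have hNFS := stub_ffrNoFreeSurface stub_ffrLens stub_ffrCircle.2 Y a ha hgap htf
  have hRD := stub_ffrRelDense Y a ha hne hgap hNFS
  have hPar := stub_ffrParity Y a ha hgap htf hF1
  have hZ := ffrS_censusZ_of hC2 hC1 hRG Y a ha hne hgap htf hF1 hPar hRD
  exact stub_ffrCountingZ Y a ha hne hgap hRD hZ

end Split

end Summit.AtomisticToContinuum.Crystallization.Theorems

end
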